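import Summits.Parity.GeneralizedHardyLittlewood.Theses.LeeYangFibres
import Summits.Parity.GeneralizedHardyLittlewood.Theorems.LeeYangFibresRelativeDimOneDefs
import Summits.Parity.GeneralizedHardyLittlewood.Theorems.LeeYangFibresRelativeDimOneTightness
import Summits.Parity.GeneralizedHardyLittlewood.Theorems.LeeYangFibresRelativeDimOneEquivalence
import Summits.Parity.GeneralizedHardyLittlewood.Theorems.LeeYangFibresRelativeDimOneNecessityDefs
import Summits.Parity.GeneralizedHardyLittlewood.Theorems.LeeYangFibresRelativeDimOneUpperAmplification
import Summits.Parity.GeneralizedHardyLittlewood.Theorems.LeeYangFibresRelativeDimOneHardness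
import Summits.Parity.GeneralizedHardyLittlewood.Theorems.LeeYangFibresRelativeDimOne
import Summits.Parity.GeneralizedHardyLittlewood.Theorems.LeeYangFibresCellParityLawSingularRatio
import HarnessLib

/-!
# Route `LeeYangFibres`, crux `RelativeDimOne` (stmt-Parity-14113), line `translate-amplification`
# (DECOUPLED form of the atom): vocabulary of the LOWER halves

Route-posited statements (D-0016 `<Route><Crux>…Defs` file), NOTHING ASSERTED, verbatim from the planner's
skeleton `Cruxes/RelativeDimOne/Lines/translate_amplification.lean` (which is not a built module), so that the
registered stub `stub_lowerAmplification : CoarseLowerHLSlack → LowerRelativeDimOne` of that line can be landed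
as a theorem file importing them:

* `CoarseLowerHLSlack` — ATOM L, the LOWER half of the line's atom `CoarseHLSlack`
  (`…RelativeDimOneDefs`): coarse lower bounds `e^{-g(T)} β_∞𝔖 ≤ S(Φ,K) + ηN` for prime constellations with
  sub-exponential loss `g(T) = o(T)` in the number of forms and `o(N)` slack (the mirror of
  `GallagherBackwards.CoarseUpperHLSlack`, `…NecessityDefs`). Open-problem strength (twin primes at `T = 2`).
* `LowerRelativeDimOne` — the LOWER half `(1 − ε) β_∞𝔖 ≤ S + εN` of the crux (the mirror of
  `GallagherBackwards.UpperRelativeDimOne`).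

Sorry-free bookkeeping (all proofs are one-line logic over the landed files of the line):
`relativeDimOne_iff_halves : RelativeDimOne ↔ (UpperRelativeDimOne ∧ LowerRelativeDimOne)` (the registered
hook this file lands under), `lowerRelativeDimOne_of_relativeDimOne`, `mainTerm_nonneg`,
`coarseLowerHLSlack_of_coarseHLSlack`, `coarseHLSlack_of_halves`, `coarseHLSlack_iff_halves` (the split
`CoarseHLSlack ↔ U ∧ L` is lossless), `coarseLowerHLSlack_of_lowerRelativeDimOne` (tightness of ATOM L),
`coarseUpperHLSlack_of_upperRelativeDimOne`, `coarseUpperHLSlack_iff_upperRelativeDimOne` (with p92176).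

References: Green–Tao, Ann. of Math. 171 (2010), Conj. 1.4 [GreenTao2010]; Tao–Vu, *Additive Combinatorics*,
§2 (tensor power trick).
-/

noncomputable section

open scoped BigOperators Classical Topology
open Finset Filter MeasureTheory Literature.NumberTheory.Sieve
open Summit.Parity.GeneralizedHardyLittlewood.Theses.LeeYangFibres (RelativeDimOne)
open Summit.Parity.GeneralizedHardyLittlewood.Cruxes.RelativeDimOne.GallagherBackwards
  (CoarseUpperHLSlack UpperRelativeDimOne upperRelativeDimOne_of_coarseUpperHLSlack
    coarseUpperHLSlack_of_coarseHLSlack upperRelativeDimOne_of_relativeDimOne)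

namespace Summit.Parity.GeneralizedHardyLittlewood.Cruxes.RelativeDimOne.TranslateAmplification

/-! ### Vocabulary of the decoupled line: the LOWER halves (the upper halves are in `…NecessityDefs`) -/

/-- ATOM L — the LOWER HALF of the atom `CoarseHLSlack`: coarse lower bounds
`e^{-g(T)} β_∞𝔖 ≤ S(Φ,K) + ηN` for prime constellations with sub-exponential loss `g(T) = o(T)` in the
number of forms and `o(N)` slack, uniformly over non-degenerate `T`-systems of size `≤ L` and convex
`K ⊆ [-N, N]` (the exact mirror of `GallagherBackwards.CoarseUpperHLSlack`). Open-problem strength: at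
`T = 2`, `Φ = (n, n+2)` it is the twin prime conjecture with the right order of magnitude. -/
def CoarseLowerHLSlack : Prop :=
  ∃ g : ℕ → ℝ, Tendsto (fun T : ℕ => g T / T) atTop (𝓝 0) ∧
    ∀ (T L : ℕ), 1 ≤ T → ∀ η : ℝ, 0 < η → ∃ N₀ : ℕ, ∀ N : ℕ, N₀ ≤ N →
      ∀ Φ : Fin T → AffLinForm 1, IsNondegenerateSystem Φ → affLinSize Φ N ≤ L →
        ∀ K : Set (Fin 1 → ℝ), Convex ℝ K → K ⊆ realBox 1 N →
          Real.exp (-g T) * (archFactor Φ K * singularProduct Φ) ≤ vonMangoldtSum Φ K N + η * N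

/-- The LOWER HALF of the crux `RelativeDimOne`: `(1 − ε) β_∞𝔖 ≤ S(Ψ,K) + εN` uniformly (the mirror
of `GallagherBackwards.UpperRelativeDimOne`; `RelativeDimOne ↔ Upper ∧ Lower`,
`relativeDimOne_iff_halves`). -/
def LowerRelativeDimOne : Prop :=
  ∀ (t L : ℕ), 1 ≤ t → ∀ ε : ℝ, 0 < ε → ∃ N₀ : ℕ, ∀ N : ℕ, N₀ ≤ N →
    ∀ Ψ : Fin t → AffLinForm 1, IsNondegenerateSystem Ψ → affLinSize Ψ N ≤ L →
      ∀ K : Set (Fin 1 → ℝ), Convex ℝ K → K ⊆ realBox 1 N →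
        (1 - ε) * (archFactor Ψ K * singularProduct Ψ) ≤ vonMangoldtSum Ψ K N + ε * N

/-! ### The crux and its two halves -/

/-- The crux is EQUIVALENT to the conjunction of its two halves: `S ≤ (1+ε)M + εN` and `(1−ε)M ≤ S + εN`
are the two sides of `|S − M| ≤ ε(M + N)` (registered hook of this vocabulary file). -/
theorem relativeDimOne_iff_halves : RelativeDimOne ↔ (UpperRelativeDimOne ∧ LowerRelativeDimOne) := by
  constructor
  · intro h
    refine ⟨upperRelativeDimOne_of_relativeDimOne h, ?_⟩
    intro t L ht ε hε
    obtain ⟨N₀, hN₀⟩ := h t L ht ε hε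
    refine ⟨N₀, fun N hN Ψ hΨ hL K hK hKN => ?_⟩
    have hb := (abs_le.mp (hN₀ N hN Ψ hΨ hL K hK hKN)).1
    linarith
  · rintro ⟨hU, hL⟩ t L ht ε hε
    obtain ⟨N₁, h₁⟩ := hU t L ht ε hε
    obtain ⟨N₂, h₂⟩ := hL t L ht ε hε
    refine ⟨max N₁ N₂, fun N hN Ψ hΨ hΨL K hK hKN => ?_⟩
    have hu := h₁ N (le_of_max_le_left hN) Ψ hΨ hΨL K hK hKN
    have hl := h₂ N (le_of_max_le_right hN) Ψ hΨ hΨL K hK hKN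
    rw [abs_le]
    constructor
    · linarith
    · linarith

/-- The crux contains its lower half. -/
theorem lowerRelativeDimOne_of_relativeDimOne : RelativeDimOne → LowerRelativeDimOne :=
  fun h => (relativeDimOne_iff_halves.mp h).2

/-! ### The split is lossless (sorry-free): U ∧ L is exactly the old atom, hence exactly the crux -/

/-- The main term `β_∞(Φ,K) 𝔖(Φ)` of a non-degenerate system is non-negative. -/
theorem mainTerm_nonneg {T : ℕ} {Φ : Fin T → AffLinForm 1} (hΦ : IsNondegenerateSystem Φ)
    (K : Set (Fin 1 → ℝ)) : 0 ≤ archFactor Φ K * singularProduct Φ :=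
  mul_nonneg (archFactor_nonneg' Φ K)
    (CellParityLaw.SectionAnnihilator.SingularRatio.singularProduct_nonneg hΦ)

/-- The old atom contains ATOM L (projection; the upper projection is
`GallagherBackwards.coarseUpperHLSlack_of_coarseHLSlack`). -/
theorem coarseLowerHLSlack_of_coarseHLSlack : CoarseHLSlack → CoarseLowerHLSlack := by
  rintro ⟨g, hg, h⟩
  refine ⟨g, hg, fun T L hT η hη => ?_⟩
  obtain ⟨N₀, hN₀⟩ := h T L hT η hη
  exact ⟨N₀, fun N hN Φ hΦ hL K hK hKN => (hN₀ N hN Φ hΦ hL K hK hKN).2⟩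

/-- ATOM U and ATOM L together give back the old two-sided atom, with the loss `max(g_U, g_L) = o(T)`. -/
theorem coarseHLSlack_of_halves : CoarseUpperHLSlack → CoarseLowerHLSlack → CoarseHLSlack := by
  rintro ⟨g₁, hg₁, h₁⟩ ⟨g₂, hg₂, h₂⟩
  refine ⟨fun T => max (g₁ T) (g₂ T), ?_, ?_⟩
  · have hmax := hg₁.max hg₂
    rw [max_self] at hmax
    refine hmax.congr' (Eventually.of_forall fun T => ?_)
    exact max_div_div_right (Nat.cast_nonneg T) (g₁ T) (g₂ T)
  · intro T L hT η hη
    obtain ⟨N₁, hN₁⟩ := h₁ T L hT η hη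
    obtain ⟨N₂, hN₂⟩ := h₂ T L hT η hη
    refine ⟨max N₁ N₂, fun N hN Φ hΦ hL K hK hKN => ?_⟩
    have hu := hN₁ N (le_of_max_le_left hN) Φ hΦ hL K hK hKN
    have hl := hN₂ N (le_of_max_le_right hN) Φ hΦ hL K hK hKN
    have hM := mainTerm_nonneg hΦ K
    constructor
    · refine hu.trans (add_le_add_left (mul_le_mul_of_nonneg_right ?_ hM) _)
      · exact Real.exp_le_exp.mpr (le_max_left _ _)
    · refine le_trans (mul_le_mul_of_nonneg_right ?_ hM) hl
      exact Real.exp_le_exp.mpr (neg_le_neg (le_max_right _ _))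

/-- **The split is lossless**: the old atom is EQUIVALENT to the conjunction of its two halves. -/
theorem coarseHLSlack_iff_halves : CoarseHLSlack ↔ (CoarseUpperHLSlack ∧ CoarseLowerHLSlack) :=
  ⟨fun h => ⟨coarseUpperHLSlack_of_coarseHLSlack h, coarseLowerHLSlack_of_coarseHLSlack h⟩,
    fun h => coarseHLSlack_of_halves h.1 h.2⟩

/-- Tightness of ATOM L (with `g ≡ 1`): the sharp lower half of the crux implies the coarse one
(`ε = min η (1/2)`: `e^{-1} M ≤ (1 − ε) M ≤ S + εN ≤ S + ηN`). With `stub_lowerAmplification` this makes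
ATOM L EQUIVALENT to `LowerRelativeDimOne` — "sharpness is free" for the lower half on its own. -/
theorem coarseLowerHLSlack_of_lowerRelativeDimOne : LowerRelativeDimOne → CoarseLowerHLSlack := by
  intro h
  refine ⟨fun _ => 1, ?_, ?_⟩
  · have h1 : Tendsto (fun T : ℕ => (1 : ℝ) / (T : ℝ)) atTop (𝓝 0) := tendsto_one_div_atTop_nhds_zero_nat
    exact h1
  · intro T L hT η hη
    obtain ⟨N₀, hN₀⟩ := h T L hT (min η (1 / 2)) (by positivity)
    refine ⟨N₀, fun N hN Φ hΦ hL K hK hKN => ?_⟩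
    have hb := hN₀ N hN Φ hΦ hL K hK hKN
    have hM := mainTerm_nonneg hΦ K
    set S := vonMangoldtSum Φ K N with hSdef
    set M := archFactor Φ K * singularProduct Φ with hMdef
    have hε1 : min η (1 / 2) ≤ η := min_le_left _ _
    have hε2 : min η (1 / 2) ≤ 1 / 2 := min_le_right _ _
    have hN0 : (0 : ℝ) ≤ N := Nat.cast_nonneg N
    have he' : Real.exp (-(1 : ℝ)) ≤ 1 / 2 := by
      have he : (2 : ℝ) ≤ Real.exp 1 := by
        have := Real.add_one_le_exp (1 : ℝ)
        linarith
      rw [Real.exp_neg, inv_le_comm₀ (Real.exp_pos 1) (by norm_num)]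
      linarith
    have hεM : min η (1 / 2) * M ≤ 1 / 2 * M := mul_le_mul_of_nonneg_right hε2 hM
    have hεN : min η (1 / 2) * (N : ℝ) ≤ η * N := mul_le_mul_of_nonneg_right hε1 hN0
    have h3 : Real.exp (-(1 : ℝ)) * M ≤ 1 / 2 * M := mul_le_mul_of_nonneg_right he' hM
    show Real.exp (-(1 : ℝ)) * M ≤ S + η * N
    nlinarith

/-- Tightness of ATOM U (with `g ≡ 1`), the mirror statement: the sharp upper half of the crux implies
the coarse one; with p92176 ATOM U is EQUIVALENT to `UpperRelativeDimOne`. -/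
theorem coarseUpperHLSlack_of_upperRelativeDimOne : UpperRelativeDimOne → CoarseUpperHLSlack := by
  intro h
  refine ⟨fun _ => 1, ?_, ?_⟩
  · have h1 : Tendsto (fun T : ℕ => (1 : ℝ) / (T : ℝ)) atTop (𝓝 0) := tendsto_one_div_atTop_nhds_zero_nat
    exact h1
  · intro T L hT η hη
    obtain ⟨N₀, hN₀⟩ := h T L hT (min η (1 / 2)) (by positivity)
    refine ⟨N₀, fun N hN Φ hΦ hL K hK hKN => ?_⟩
    have hb := hN₀ N hN Φ hΦ hL K hK hKN
    have hM := mainTerm_nonneg hΦ K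
    set S := vonMangoldtSum Φ K N with hSdef
    set M := archFactor Φ K * singularProduct Φ with hMdef
    have hε1 : min η (1 / 2) ≤ η := min_le_left _ _
    have hε2 : min η (1 / 2) ≤ 1 / 2 := min_le_right _ _
    have hN0 : (0 : ℝ) ≤ N := Nat.cast_nonneg N
    have he : (2 : ℝ) ≤ Real.exp 1 := by
      have := Real.add_one_le_exp (1 : ℝ)
      linarith
    have hεM : min η (1 / 2) * M ≤ 1 / 2 * M := mul_le_mul_of_nonneg_right hε2 hM
    have hεN : min η (1 / 2) * (N : ℝ) ≤ η * N := mul_le_mul_of_nonneg_right hε1 hN0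
    have h2 : (1 + 1 / 2) * M ≤ Real.exp 1 * M := mul_le_mul_of_nonneg_right (by linarith) hM
    show S ≤ Real.exp 1 * M + η * N
    nlinarith

/-- ATOM U ↔ the upper half of the crux (both directions in the tree now). -/
theorem coarseUpperHLSlack_iff_upperRelativeDimOne : CoarseUpperHLSlack ↔ UpperRelativeDimOne :=
  ⟨upperRelativeDimOne_of_coarseUpperHLSlack, coarseUpperHLSlack_of_upperRelativeDimOne⟩

end Summit.Parity.GeneralizedHardyLittlewood.Cruxes.RelativeDimOne.TranslateAmplification
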